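import Summits.NavierStokesRegularity.NavierStokesRegularity.Theses.QuantisedSymmetry
import Summits.NavierStokesRegularity.NavierStokesRegularity.Theorems.QuantisedSymmetryPolyhedralDssProfileExistsStubSmoothRepresentativeAe
import Summits.NavierStokesRegularity.NavierStokesRegularity.Theorems.QuantisedSymmetryPolyhedralDssProfileExistsStubTransportAe
import Summits.NavierStokesRegularity.NavierStokesRegularity.Theorems.QuantisedSymmetryPolyhedralDssProfileExistsStubCellOfRepresentative
import Summits.NavierStokesRegularity.NavierStokesRegularity.Theorems.QuantisedSymmetryPolyhedralDssProfileExistsOfCell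
import HarnessLib

/-!
# Route `QuantisedSymmetry`, crux `PolyhedralDssProfileExists` (X⁻, stmt-NavierStokesRegularity-1404), line
# `polyhedral_cell` — registered stub `stub_cellOfProfile` (lead c15): THE CRUX YIELDS A POLYHEDRAL CELL, and
# `PolyhedralDssProfileExists ↔ PolyhedralCellExists`

The line reduces X⁻ (a nontrivial `G`-equivariant Type-I `λ`-DSS ancient mild profile, `G` finite irreducible,
proper rotations) to ONE polyhedral cell — a bounded continuous weakly solenoidal `G`-equivariant field `v` on the
model period `[-1, -λ⁻²] × ℝ³`, Oseen-mild between model times, closing up under the zoom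
`v(-λ⁻², x) = λ v(-1, λx)`, with `L⁴` datum not a.e. zero — and the reduction cell ⇒ X⁻ is the landed
`stub_profileOfPolyhedralCell` (p152884). This file runs it BACKWARDS, assembling the landed stubs
`stub_smoothRepresentative_ae` (p156260: Oseen-gauge representative, slice-wise a.e. equal, normalised on `t ≥ 0`),
`stub_transport_ae` (p155960: exact DSS and equivariance pass to the continuous representative) and
`stub_cellOfRepresentative` (p156090: a normalised representative restricts to a cell): X⁻ ⇒ cell. Hence the ∃-content
left open by the line is EXACTLY the crux: `polyhedralDssProfileExists_iff_cell`.
-/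

set_option linter.dupNamespace false

namespace Summit.NavierStokesRegularity.NavierStokesRegularity.Theorems.PolyhedralDssProfileExists.PolyhedralCell

open MeasureTheory Set Function Filter Topology
open Literature.Analysis.FluidPDE

/-- **A representative of a not-a.e.-trivial family is nonzero somewhere.** If `V t = u t` a.e. for every
`t < 0` and not every negative slice of `u` is a.e. zero, then `V t₀ x₀ ≠ 0` for some `t₀ < 0`, `x₀`. [folklore] -/
theorem exists_apply_ne_zero_of_ae_repr
    {u V : ℝ → EuclideanSpace ℝ (Fin 3) → EuclideanSpace ℝ (Fin 3)}
    (hae : ∀ t < 0, V t =ᵐ[volume] u t) (hnt : ¬ ∀ t < 0, u t =ᵐ[volume] 0) :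
    ∃ t₀ < 0, ∃ x₀, V t₀ x₀ ≠ 0 := by
  by_contra h
  push Not at h
  refine hnt fun t ht => ?_
  have hVt : V t = (0 : EuclideanSpace ℝ (Fin 3) → EuclideanSpace ℝ (Fin 3)) := funext (h t ht)
  rw [← hVt]
  exact (hae t ht).symm

/-- **REGISTERED STUB `stub_cellOfProfile` (line `polyhedral_cell`, lead c15): the crux yields a polyhedral
cell.** Given a witness `(G, λ, u)` of `PolyhedralDssProfileExists`: take the Oseen-gauge representative `V`
(`stub_smoothRepresentative_ae`), transport exact `λ`-DSS and `G`-equivariance to it (`stub_transport_ae`),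
pick a point where `V` is nonzero (a.e. equality with the nontrivial `u`), and restrict the parabolically
normalised representative to the model period (`stub_cellOfRepresentative`); the group is the same `G` and the
factor the same `λ`. [cite: BradshawTsai2017CPDE, §1 and §5 Open Problem 5.1; KochNadirashviliSereginSverak2009, §4] -/
theorem stub_cellOfProfile :
    _root_.Summit.NavierStokesRegularity.NavierStokesRegularity.Theses.QuantisedSymmetry.PolyhedralDssProfileExists →
      ∃ G : Subgroup (EuclideanSpace ℝ (Fin 3) ≃ₗᵢ[ℝ] EuclideanSpace ℝ (Fin 3)), Finite G ∧
      (∀ g ∈ G, LinearMap.det (g.toLinearEquiv : EuclideanSpace ℝ (Fin 3) →ₗ[ℝ] EuclideanSpace ℝ (Fin 3)) = 1) ∧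
      (∀ V : Submodule ℝ (EuclideanSpace ℝ (Fin 3)), (∀ g ∈ G, ∀ v ∈ V, g v ∈ V) → V = ⊥ ∨ V = ⊤) ∧
      ∃ c : ℝ, 1 < c ∧ ∃ v : ℝ → EuclideanSpace ℝ (Fin 3) → EuclideanSpace ℝ (Fin 3),
        (ContinuousOn (Function.uncurry v) (Set.Icc (-1 : ℝ) (-(c ^ 2)⁻¹) ×ˢ Set.univ) ∧
          (∃ M : ℝ, ∀ t ∈ Set.Icc (-1 : ℝ) (-(c ^ 2)⁻¹), ∀ x, ‖v t x‖ ≤ M) ∧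
          (∀ t ∈ Set.Icc (-1 : ℝ) (-(c ^ 2)⁻¹), IsWeaklyDivFree (v t)) ∧
          (∀ s t : ℝ, -1 ≤ s → s < t → t ≤ -(c ^ 2)⁻¹ → ∀ x,
            v t x = heatFlow (v s) (t - s) x - oseenDuhamel 1 s v v t x) ∧
          (∀ x, v (-(c ^ 2)⁻¹) x = c • v (-1) (c • x)) ∧
          (∀ g ∈ G, ∀ t ∈ Set.Icc (-1 : ℝ) (-(c ^ 2)⁻¹), ∀ x, v t (g x) = g (v t x))) ∧
        MemLp (v (-1)) 4 volume ∧ ¬ (v (-1) =ᵐ[volume] 0) := by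
  rintro ⟨G, hfin, hdet, hirr, c, hc, u, hanc, hmeas, hdss, ⟨C₀, hdec⟩, heqv, hnt⟩
  obtain ⟨V, C, hV, hdecV, hae, hzero⟩ := stub_smoothRepresentative_ae u C₀ hanc hmeas hdec
  obtain ⟨hdssV, heqvV⟩ := stub_transport_ae G c u V C hc hdss heqv hV hae hzero
  obtain ⟨t₀, ht₀, x₀, hx₀⟩ := exists_apply_ne_zero_of_ae_repr hae hnt
  obtain ⟨v, hcell, hL4, hnt'⟩ :=
    stub_cellOfRepresentative G c V C C₀ t₀ x₀ hc hV hdssV hdecV heqvV ht₀ hx₀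
  exact ⟨G, hfin, hdet, hirr, c, hc, v, hcell, hL4, hnt'⟩

/-- **`PolyhedralDssProfileExists ↔ PolyhedralCellExists`.** The crux of route `QuantisedSymmetry` is EQUIVALENT to
the existence of one polyhedral cell with `L⁴` datum (the body of the line's only open stub
`stub_polyhedralCellExists`): `→` is `stub_cellOfProfile`, `←` is the landed reduction `stub_profileOfPolyhedralCell`
(p152884: concatenation along the zoom, Oseen-mild gluing, `L⁴` propagation, KNSS regularity, Chae–Wolf 2017 Thm 1.1).
So promoting / restating the ∃-stub loses nothing and adds nothing. [cite: BradshawTsai2017CPDE, §5 Open Problem 5.1; ChaeWolf2017RemovingDSS, Thm 1.1] -/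
theorem polyhedralDssProfileExists_iff_cell :
    _root_.Summit.NavierStokesRegularity.NavierStokesRegularity.Theses.QuantisedSymmetry.PolyhedralDssProfileExists ↔
      ∃ G : Subgroup (EuclideanSpace ℝ (Fin 3) ≃ₗᵢ[ℝ] EuclideanSpace ℝ (Fin 3)), Finite G ∧
      (∀ g ∈ G, LinearMap.det (g.toLinearEquiv : EuclideanSpace ℝ (Fin 3) →ₗ[ℝ] EuclideanSpace ℝ (Fin 3)) = 1) ∧
      (∀ V : Submodule ℝ (EuclideanSpace ℝ (Fin 3)), (∀ g ∈ G, ∀ v ∈ V, g v ∈ V) → V = ⊥ ∨ V = ⊤) ∧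
      ∃ c : ℝ, 1 < c ∧ ∃ v : ℝ → EuclideanSpace ℝ (Fin 3) → EuclideanSpace ℝ (Fin 3),
        (ContinuousOn (Function.uncurry v) (Set.Icc (-1 : ℝ) (-(c ^ 2)⁻¹) ×ˢ Set.univ) ∧
          (∃ M : ℝ, ∀ t ∈ Set.Icc (-1 : ℝ) (-(c ^ 2)⁻¹), ∀ x, ‖v t x‖ ≤ M) ∧
          (∀ t ∈ Set.Icc (-1 : ℝ) (-(c ^ 2)⁻¹), IsWeaklyDivFree (v t)) ∧
          (∀ s t : ℝ, -1 ≤ s → s < t → t ≤ -(c ^ 2)⁻¹ → ∀ x,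
            v t x = heatFlow (v s) (t - s) x - oseenDuhamel 1 s v v t x) ∧
          (∀ x, v (-(c ^ 2)⁻¹) x = c • v (-1) (c • x)) ∧
          (∀ g ∈ G, ∀ t ∈ Set.Icc (-1 : ℝ) (-(c ^ 2)⁻¹), ∀ x, v t (g x) = g (v t x))) ∧
        MemLp (v (-1)) 4 volume ∧ ¬ (v (-1) =ᵐ[volume] 0) :=
  ⟨stub_cellOfProfile, stub_profileOfPolyhedralCell⟩

/-- **Same group, same factor.** The equivalence is fibrewise over `(G, λ)`: for a fixed finite irreducible
rotation group `G` and factor `λ > 1`, a `G`-equivariant Type-I `λ`-DSS nontrivial ancient mild profile exists iff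
a `G`-cell with factor `λ` and nontrivial `L⁴` datum exists (both reductions keep `G` and `λ`). [folklore] -/
theorem profile_iff_cell_fibre (G : Subgroup (EuclideanSpace ℝ (Fin 3) ≃ₗᵢ[ℝ] EuclideanSpace ℝ (Fin 3)))
    {c : ℝ} (hc : 1 < c) :
    (∃ u : ℝ → EuclideanSpace ℝ (Fin 3) → EuclideanSpace ℝ (Fin 3),
        IsAncientMildSolution 1 u ∧ (∀ t < 0, AEStronglyMeasurable (u t) volume) ∧
        IsDiscretelySelfSimilar c u ∧ (∃ C₀ : ℝ, HasTypeIDecay C₀ u) ∧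
        (∀ g ∈ G, ∀ t x, u t (g x) = g (u t x)) ∧ ¬ (∀ t < 0, u t =ᵐ[volume] 0)) ↔
      ∃ v : ℝ → EuclideanSpace ℝ (Fin 3) → EuclideanSpace ℝ (Fin 3),
        (ContinuousOn (Function.uncurry v) (Set.Icc (-1 : ℝ) (-(c ^ 2)⁻¹) ×ˢ Set.univ) ∧
          (∃ M : ℝ, ∀ t ∈ Set.Icc (-1 : ℝ) (-(c ^ 2)⁻¹), ∀ x, ‖v t x‖ ≤ M) ∧
          (∀ t ∈ Set.Icc (-1 : ℝ) (-(c ^ 2)⁻¹), IsWeaklyDivFree (v t)) ∧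
          (∀ s t : ℝ, -1 ≤ s → s < t → t ≤ -(c ^ 2)⁻¹ → ∀ x,
            v t x = heatFlow (v s) (t - s) x - oseenDuhamel 1 s v v t x) ∧
          (∀ x, v (-(c ^ 2)⁻¹) x = c • v (-1) (c • x)) ∧
          (∀ g ∈ G, ∀ t ∈ Set.Icc (-1 : ℝ) (-(c ^ 2)⁻¹), ∀ x, v t (g x) = g (v t x))) ∧
        MemLp (v (-1)) 4 volume ∧ ¬ (v (-1) =ᵐ[volume] 0) := by
  constructor
  · rintro ⟨u, hanc, hmeas, hdss, ⟨C₀, hdec⟩, heqv, hnt⟩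
    obtain ⟨V, C, hV, hdecV, hae, hzero⟩ := stub_smoothRepresentative_ae u C₀ hanc hmeas hdec
    obtain ⟨hdssV, heqvV⟩ := stub_transport_ae G c u V C hc hdss heqv hV hae hzero
    obtain ⟨t₀, ht₀, x₀, hx₀⟩ := exists_apply_ne_zero_of_ae_repr hae hnt
    exact stub_cellOfRepresentative G c V C C₀ t₀ x₀ hc hV hdssV hdecV heqvV ht₀ hx₀
  · rintro ⟨v, hcell, hL4, hnt⟩
    obtain ⟨u, p, -, hanc, hmeas, hdss, ⟨C₀, -, hC₀, -⟩, heqv, hu1, -⟩ := typeIDss_of_cell G hc hcell hL4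
    refine ⟨u, hanc, hmeas, hdss, ⟨C₀, hC₀⟩, heqv, fun hzero => hnt ?_⟩
    have h1 := hzero (-1) (by norm_num)
    rwa [hu1] at h1

end Summit.NavierStokesRegularity.NavierStokesRegularity.Theorems.PolyhedralDssProfileExists.PolyhedralCell
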